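import Mathlib.Algebra.Field.IsField
import Literature.Algebra.EuclideanDomain.EuclideanOrderTypeProduct
import Literature.Algebra.EuclideanDomain.EuclideanOrderTypeFinite
import HarnessLib

/-!
# The Euclidean order type of a product of non-field Euclidean domains is a limit ordinal (Clark 2015, Thm. 25 (b))

Topic `Literature/Algebra/EuclideanDomain`, namespace `Literature.Algebra.EuclideanDomain`.  THEOREMS ONLY (no `def`, no
instance, no named fact), all proved, in the vocabulary of `TransfiniteSmallestAlgorithm.lean` (`samuelSet R α = A_α`,
`samuelRank = θ`; «`R` is Euclidean» = the transfinite construction exhausts `R`, hypothesis `h`) and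
`EuclideanOrderTypeIndecomposable.lean` (`e(R) = ⨆ z, ((θ z − 1) + 1)`, the least ordinal exceeding every value
`τ(z) = θ(z) − 1` of the minimal Euclidean norm).

## Source (read at the page)

P. L. Clark, *A note on Euclidean order types*, Order **32** (2015) 157–178 [Clark2015EuclideanOrderTypes] (materialised
`paper:arxiv-1208.0977`, arXiv numbering; `p0007.txt`), VERBATIM.  **Theorem 25.** «Let `R = ∏_{i=1}^r R_i × A = R′ × A` be a
Euclidean ring.  a) We have `e(R) = e(R′) + ℓ(A)`.  b) `e(R′)` is a limit ordinal (possibly zero).  c) `e(R′) ≥ rω`.  Proof. …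
The remaining assertions hold trivially if `r = 0`, so we assume `r ≥ 1`.  b) Since `R′` is a product of domains, the set of
nonzero ideals of `R` has no minimal element, so `e(R′)` is a nonzero limit ordinal.»  Here (Thm. 6 (b), the structure
theorem, p0004) `R ≅ ∏_{i=1}^n R_i × A` with `R_i` principal ideal domains and `A` the Artinian part; for the argument of (b)
the `R_i` are NOT fields (a field factor has a minimal non-zero ideal and belongs to the Artinian part).  The mechanism is
Prop. 15 / Cor. 12 (p0005) «the bottom Euclidean function `φ_R` is isotone» in its strict form (Samuel 1971, Prop. 4 (b),
p. 284: `θ(x) < θ(y)` when `x ∣ y` and `(y) ≠ (x)`), typed in `EuclideanOrderTypeFinite.lean`.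

## What is formalised

* §1 The mechanism of (b) for ANY ring exhausted by its transfinite construction: **if every non-zero `x` has a non-zero
  strict multiple `y` (`x ∣ y`, `(y) ≠ (x)`) — «the set of nonzero [principal] ideals has no minimal element» — then `e(R)`
  is a non-zero limit ordinal** (`isSuccLimit_iSup_samuelRank_of_forall_exists_dvd`, Mathlib's `Order.IsSuccLimit`): a value
  `τ(x) + 1` attaining the supremum is beaten by `τ(y) ≥ τ(x) + 1` (`samuelRank_sub_one_add_one_le_of_dvd`).
* §2 `r = 1`: for a Euclidean domain which is not a field `e(R)` is a non-zero limit ordinal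
  (`isSuccLimit_iSup_samuelRank_of_not_isField`, `…_of_euclideanDomain_of_not_isField`), `ω ∣ e(R)`, and — with
  Conidis–Nielsen–Tombs' `e(R) = ω^a` of `EuclideanOrderTypeIndecomposable.lean` — the exponent is `a ≥ 1`
  (`log_omega0_iSup_samuelRank_pos`).
* §3 **Thm. 25 (b) as printed**: for a finite non-empty family of non-field domains `R_i`, each exhausted by its transfinite
  construction, `e(∏ R_i)` is a non-zero limit ordinal (`Pi.isSuccLimit_iSup_samuelRank`; two factors:
  `Prod.isSuccLimit_iSup_samuelRank`).  Scope: Clark's «possibly zero» is the case `r = 0` (`R′ = 0`, `e(0) = 0` in his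
  normalisation); in the tree's convention every ring, the zero ring included, has `e ≥ 1` (`iSup_samuelRank_ne_zero`), so the
  statement is made for `r ≥ 1` (`Nonempty ι`), exactly the case Clark proves.

## Mathlib / tree search

Mathlib: `Order.IsSuccLimit`, `Ordinal.isSuccLimit_iff`, `exists_eq_ciSup_of_not_isSuccPrelimit`,
`Ordinal.isSuccPrelimit_iff_omega0_dvd`, `Ordinal.log_pos`, `Order.add_one_le_of_lt`, `IsUnit.of_mul_eq_one`, `Pi.mulSingle`,
`Pi.nontrivial_at`.  Tree: `EuclideanOrderTypeFinite.lean` (`samuelRank_lt_of_dvd_of_span_singleton_ne`),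
`EuclideanOrderTypeIndecomposable.lean` (`samuelRank_sub_one_lt_iSup`, `iSup_samuelRank_ne_zero`, `iSup_samuelRank_eq_omega0_opow`),
`TransfiniteSmallestAlgorithmSuperadditive.lean` (`one_add_samuelRank_sub_one`), `EuclideanOrderTypeProduct.lean`
(`omega0_le_iSup_samuelRank_of_not_isUnit`), `ProductOfEuclideanRings.lean` (`Pi.forall_exists_mem_samuelSet`,
`Prod.forall_exists_mem_samuelSet`), `EuclideanDomainIffTransfiniteConstruction.lean`
(`forall_exists_mem_samuelSet_of_euclideanDomain`); `rg "IsSuccLimit|IsLimit" Literature/Algebra/EuclideanDomain` → nothing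
before this file.
-/

namespace Literature.Algebra.EuclideanDomain

open Ordinal Order

universe u v

variable {R : Type u} [CommRing R]

/-! ## §1 No minimal non-zero principal ideal ⟹ `e(R)` is a limit ordinal -/

section Mechanism

/-- Strict divisibility raises the value `τ + 1`: if `x ∣ y`, `(y) ≠ (x)`, `x, y ≠ 0` (in a ring exhausted by its
transfinite construction) then `(θ(x) − 1) + 1 ≤ θ(y) − 1`, from `θ(x) < θ(y)`. [cite: Clark2015EuclideanOrderTypes, Prop. 15
and proof of Thm. 25 (b); Samuel1971, Prop. 4 (b) (p. 284)] -/
theorem samuelRank_sub_one_add_one_le_of_dvd (h : ∀ z : R, ∃ α : Ordinal.{u}, z ∈ samuelSet R α) {x y : R}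
    (hxy : x ∣ y) (hne : Ideal.span ({y} : Set R) ≠ Ideal.span {x}) (hx0 : x ≠ 0) (hy0 : y ≠ 0) :
    samuelRank x - 1 + 1 ≤ samuelRank y - 1 := by
  have hlt : samuelRank x < samuelRank y := samuelRank_lt_of_dvd_of_span_singleton_ne hxy hne hy0 (h y)
  rw [← one_add_samuelRank_sub_one h hx0, ← one_add_samuelRank_sub_one h hy0, add_lt_add_iff_left] at hlt
  exact add_one_le_of_lt hlt

/-- A nonzero non-unit exists in a non-trivial commutative ring which is not a field (private helper). [folklore] -/
private theorem exists_ne_zero_and_not_isUnit [Nontrivial R] (hR : ¬ IsField R) : ∃ p : R, p ≠ 0 ∧ ¬ IsUnit p := by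
  by_contra hne
  push Not at hne
  exact hR ⟨exists_pair_ne R, mul_comm, fun ha ↦ (hne _ ha).exists_right_inv⟩

/-- **The mechanism of Thm. 25 (b).**  If `R ≠ 0` is exhausted by its transfinite construction and every non-zero `x ∈ R`
has a non-zero strict multiple (`x ∣ y`, `(y) ≠ (x)`: «the set of nonzero ideals of `R` has no minimal element»), then the
Euclidean order type `e(R)` is a non-zero limit ordinal. [cite: Clark2015EuclideanOrderTypes, Thm. 25 (b) (proof)] -/
theorem isSuccLimit_iSup_samuelRank_of_forall_exists_dvd [Nontrivial R]
    (h : ∀ z : R, ∃ α : Ordinal.{u}, z ∈ samuelSet R α)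
    (hmin : ∀ x : R, x ≠ 0 → ∃ y : R, y ≠ 0 ∧ x ∣ y ∧ Ideal.span ({y} : Set R) ≠ Ideal.span {x}) :
    IsSuccLimit (⨆ z : R, (samuelRank z - 1 + 1)) := by
  refine Ordinal.isSuccLimit_iff.2 ⟨iSup_samuelRank_ne_zero, ?_⟩
  by_contra hnot
  obtain ⟨z, hz⟩ := exists_eq_ciSup_of_not_isSuccPrelimit hnot
  -- the values at `0` and at `1` coincide (both are `1`), so a non-zero `x` attains the supremum
  obtain ⟨x, hx0, hx⟩ : ∃ x : R, x ≠ 0 ∧ samuelRank x - 1 + 1 = ⨆ z : R, (samuelRank z - 1 + 1) := by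
    by_cases hz0 : z = 0
    · refine ⟨1, one_ne_zero, ?_⟩
      rw [← hz, hz0, samuelRank_zero, samuelRank_eq_one_iff.2 ⟨one_ne_zero, isUnit_one⟩, Ordinal.sub_self,
        Ordinal.zero_sub]
    · exact ⟨z, hz0, hz⟩
  obtain ⟨y, hy0, hxy, hne⟩ := hmin x hx0
  have h1 := samuelRank_sub_one_add_one_le_of_dvd h hxy hne hx0 hy0
  have h2 := samuelRank_sub_one_lt_iSup y
  rw [← hx] at h2
  exact lt_irrefl _ (h1.trans_lt h2)

end Mechanism

/-! ## §2 Domains which are not fields -/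

section Domain

variable [IsDomain R]

/-- In a domain which is not a field every non-zero `x` has the non-zero strict multiple `xp`, `p` a non-zero non-unit.
[cite: Clark2015EuclideanOrderTypes, proof of Thm. 25 (b)] -/
theorem exists_dvd_span_singleton_ne_of_not_isField (hR : ¬ IsField R) {x : R} (hx0 : x ≠ 0) :
    ∃ y : R, y ≠ 0 ∧ x ∣ y ∧ Ideal.span ({y} : Set R) ≠ Ideal.span {x} := by
  obtain ⟨p, hp0, hpu⟩ := exists_ne_zero_and_not_isUnit hR
  refine ⟨x * p, mul_ne_zero hx0 hp0, Dvd.intro p rfl, fun heq ↦ hpu ?_⟩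
  obtain ⟨c, hc⟩ : x * p ∣ x := Ideal.span_singleton_le_span_singleton.1 heq.ge
  exact IsUnit.of_mul_eq_one c (mul_left_cancel₀ hx0 (by rw [← mul_assoc, ← hc, mul_one]))

/-- **Thm. 25 (b), one factor**: the Euclidean order type of a domain which is not a field and is exhausted by its transfinite
construction is a non-zero limit ordinal. [cite: Clark2015EuclideanOrderTypes, Thm. 25 (b)] -/
theorem isSuccLimit_iSup_samuelRank_of_not_isField (hR : ¬ IsField R)
    (h : ∀ z : R, ∃ α : Ordinal.{u}, z ∈ samuelSet R α) : IsSuccLimit (⨆ z : R, (samuelRank z - 1 + 1)) :=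
  isSuccLimit_iSup_samuelRank_of_forall_exists_dvd h fun _ hx0 ↦ exists_dvd_span_singleton_ne_of_not_isField hR hx0

/-- Hence `ω ∣ e(R)` for such a domain. [cite: Clark2015EuclideanOrderTypes, Thm. 25 (b)] -/
theorem omega0_dvd_iSup_samuelRank_of_not_isField (hR : ¬ IsField R)
    (h : ∀ z : R, ∃ α : Ordinal.{u}, z ∈ samuelSet R α) : ω ∣ ⨆ z : R, (samuelRank z - 1 + 1) :=
  Ordinal.isSuccPrelimit_iff_omega0_dvd.1 (isSuccLimit_iSup_samuelRank_of_not_isField hR h).isSuccPrelimit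

/-- With Conidis–Nielsen–Tombs (`e(R) = ω^a`, `a = log_ω e(R)`, `iSup_samuelRank_eq_omega0_opow`): for a non-field domain the
exponent is positive, `a ≥ 1` (as `ω ≤ e(R)`). [cite: Clark2015EuclideanOrderTypes, Thm. 25 (b)(c)] -/
theorem log_omega0_iSup_samuelRank_pos (hR : ¬ IsField R) (h : ∀ z : R, ∃ α : Ordinal.{u}, z ∈ samuelSet R α) :
    0 < Ordinal.log ω (⨆ z : R, (samuelRank z - 1 + 1)) := by
  obtain ⟨p, hp0, hpu⟩ := exists_ne_zero_and_not_isUnit hR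
  exact Ordinal.log_pos one_lt_omega0 iSup_samuelRank_ne_zero (omega0_le_iSup_samuelRank_of_not_isUnit h hp0 hpu)

end Domain

/-- **Thm. 25 (b) for a Euclidean domain** (Mathlib's `EuclideanDomain`) which is not a field: `e(R)` is a non-zero limit
ordinal. [cite: Clark2015EuclideanOrderTypes, Thm. 25 (b)] -/
theorem isSuccLimit_iSup_samuelRank_of_euclideanDomain_of_not_isField {R : Type u} [EuclideanDomain R] (hR : ¬ IsField R) :
    IsSuccLimit (⨆ z : R, (samuelRank z - 1 + 1)) :=
  isSuccLimit_iSup_samuelRank_of_not_isField hR forall_exists_mem_samuelSet_of_euclideanDomain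

/-! ## §3 Thm. 25 (b): products of non-field domains -/

section Product

/-- In a product of non-field domains every non-zero `x` has a non-zero strict multiple: multiply one non-zero coordinate by a
non-unit («since `R′` is a product of domains, the set of nonzero ideals has no minimal element»).
[cite: Clark2015EuclideanOrderTypes, proof of Thm. 25 (b)] -/
theorem Pi.exists_dvd_span_singleton_ne {ι : Type u} {A : ι → Type v} [∀ i, CommRing (A i)] [∀ i, IsDomain (A i)]
    (hA : ∀ i, ¬ IsField (A i)) {x : Π i, A i} (hx0 : x ≠ 0) :
    ∃ y : Π i, A i, y ≠ 0 ∧ x ∣ y ∧ Ideal.span ({y} : Set (Π i, A i)) ≠ Ideal.span {x} := by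
  classical
  obtain ⟨i, hi⟩ : ∃ i, x i ≠ 0 := Function.ne_iff.1 hx0
  obtain ⟨p, hp0, hpu⟩ := exists_ne_zero_and_not_isUnit (hA i)
  refine ⟨x * Pi.mulSingle i p, fun h0 ↦ mul_ne_zero hi hp0 ?_, Dvd.intro _ rfl, fun heq ↦ hpu ?_⟩
  · have := congr_fun h0 i
    rwa [Pi.mul_apply, Pi.mulSingle_eq_same] at this
  · obtain ⟨c, hc⟩ : x * Pi.mulSingle i p ∣ x := Ideal.span_singleton_le_span_singleton.1 heq.ge
    have hci := congr_fun hc i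
    rw [Pi.mul_apply, Pi.mul_apply, Pi.mulSingle_eq_same] at hci
    exact IsUnit.of_mul_eq_one (c i) (mul_left_cancel₀ hi (by rw [← mul_assoc, ← hci, mul_one]))

/-- **Thm. 25 (b) «`e(R′)` is a limit ordinal», `R′ = ∏_{i=1}^r R_i`, `r ≥ 1`**: for a finite non-empty family of domains
`R_i`, none a field, each exhausted by its transfinite construction, the Euclidean order type of `∏ R_i` is a non-zero limit
ordinal. [cite: Clark2015EuclideanOrderTypes, Thm. 25 (b)] -/
theorem Pi.isSuccLimit_iSup_samuelRank {ι : Type u} [Finite ι] [Nonempty ι] {A : ι → Type v} [∀ i, CommRing (A i)]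
    [∀ i, IsDomain (A i)] (hA : ∀ i, ¬ IsField (A i))
    (h : ∀ i, ∀ x : A i, ∃ α : Ordinal.{v}, x ∈ samuelSet (A i) α) :
    IsSuccLimit (⨆ z : (Π i, A i), (samuelRank z - 1 + 1)) := by
  obtain ⟨i⟩ := ‹Nonempty ι›
  haveI := Pi.nontrivial_at (f := A) i
  exact isSuccLimit_iSup_samuelRank_of_forall_exists_dvd (Pi.forall_exists_mem_samuelSet h)
    fun _ hx0 ↦ Pi.exists_dvd_span_singleton_ne hA hx0

/-- Thm. 25 (b) for a family of Euclidean domains (Mathlib's `EuclideanDomain`), none a field.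
[cite: Clark2015EuclideanOrderTypes, Thm. 25 (b)] -/
theorem Pi.isSuccLimit_iSup_samuelRank_of_euclideanDomain {ι : Type u} [Finite ι] [Nonempty ι] {A : ι → Type v}
    [∀ i, EuclideanDomain (A i)] (hA : ∀ i, ¬ IsField (A i)) :
    IsSuccLimit (⨆ z : (Π i, A i), (samuelRank z - 1 + 1)) :=
  Pi.isSuccLimit_iSup_samuelRank hA fun i ↦ forall_exists_mem_samuelSet_of_euclideanDomain (R := A i)

/-- Two factors: in `R × S`, `R`, `S` non-field domains, every non-zero element has a non-zero strict multiple.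
[cite: Clark2015EuclideanOrderTypes, proof of Thm. 25 (b)] -/
theorem Prod.exists_dvd_span_singleton_ne {S : Type v} [CommRing S] [IsDomain R] [IsDomain S] (hR : ¬ IsField R)
    (hS : ¬ IsField S) {x : R × S} (hx0 : x ≠ 0) :
    ∃ y : R × S, y ≠ 0 ∧ x ∣ y ∧ Ideal.span ({y} : Set (R × S)) ≠ Ideal.span {x} := by
  obtain ⟨p, hp0, hpu⟩ := exists_ne_zero_and_not_isUnit hR
  obtain ⟨q, hq0, hqu⟩ := exists_ne_zero_and_not_isUnit hS
  by_cases h1 : x.1 = 0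
  · have h2 : x.2 ≠ 0 := fun h2 ↦ hx0 (Prod.ext h1 h2)
    refine ⟨x * (1, q), fun h0 ↦ mul_ne_zero h2 hq0 (congr_arg Prod.snd h0), Dvd.intro _ rfl, fun heq ↦ hqu ?_⟩
    obtain ⟨c, hc⟩ : x * (1, q) ∣ x := Ideal.span_singleton_le_span_singleton.1 heq.ge
    have hc2 : x.2 = x.2 * q * c.2 := congr_arg Prod.snd hc
    exact IsUnit.of_mul_eq_one c.2 (mul_left_cancel₀ h2 (by rw [← mul_assoc, ← hc2, mul_one]))
  · refine ⟨x * (p, 1), fun h0 ↦ mul_ne_zero h1 hp0 (congr_arg Prod.fst h0), Dvd.intro _ rfl, fun heq ↦ hpu ?_⟩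
    obtain ⟨c, hc⟩ : x * (p, 1) ∣ x := Ideal.span_singleton_le_span_singleton.1 heq.ge
    have hc1 : x.1 = x.1 * p * c.1 := congr_arg Prod.fst hc
    exact IsUnit.of_mul_eq_one c.1 (mul_left_cancel₀ h1 (by rw [← mul_assoc, ← hc1, mul_one]))

/-- **Thm. 25 (b), two factors**: for non-field domains `R`, `S` exhausted by their transfinite constructions, `e(R × S)` is a
non-zero limit ordinal. [cite: Clark2015EuclideanOrderTypes, Thm. 25 (b)] -/
theorem Prod.isSuccLimit_iSup_samuelRank {S : Type v} [CommRing S] [IsDomain R] [IsDomain S] (hR : ¬ IsField R)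
    (hS : ¬ IsField S) (h₁ : ∀ z : R, ∃ α : Ordinal.{u}, z ∈ samuelSet R α)
    (h₂ : ∀ z : S, ∃ α : Ordinal.{v}, z ∈ samuelSet S α) :
    IsSuccLimit (⨆ z : R × S, (samuelRank z - 1 + 1)) :=
  isSuccLimit_iSup_samuelRank_of_forall_exists_dvd (Prod.forall_exists_mem_samuelSet h₁ h₂)
    fun _ hx0 ↦ Prod.exists_dvd_span_singleton_ne hR hS hx0

/-- Thm. 25 (b) for two Euclidean domains (Mathlib's `EuclideanDomain`), neither a field; e.g. `e(ℤ × ℤ) = ω·2`.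
[cite: Clark2015EuclideanOrderTypes, Thm. 25 (b)] -/
theorem Prod.isSuccLimit_iSup_samuelRank_of_euclideanDomain {R : Type u} {S : Type v} [EuclideanDomain R]
    [EuclideanDomain S] (hR : ¬ IsField R) (hS : ¬ IsField S) :
    IsSuccLimit (⨆ z : R × S, (samuelRank z - 1 + 1)) :=
  Prod.isSuccLimit_iSup_samuelRank hR hS forall_exists_mem_samuelSet_of_euclideanDomain
    forall_exists_mem_samuelSet_of_euclideanDomain

end Product

end Literature.Algebra.EuclideanDomain
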